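import Summits.FinalStateConjecture.FinalStateConjecture.Theorems.EIHFluxBalanceInertialRecessionStubQuasiStationarityKinematics
import Summits.FinalStateConjecture.FinalStateConjecture.Theorems.EIHFluxBalanceInertialRecessionStubQuasiStationarityLorentzAlgebra

/-!
# Route EIHFluxBalance — `InertialRecession`, line `sublinear-is-free-clean-window-charges`,
# stub `stub_quasiStationarity`: the structural estimate for `∂₀` of one painted summand

Helper file (part 5 of the kinematic reduction of the stub `stub_quasiStationarity` of the crux
`stmt-FinalStateConjecture-10166`). The main theorem `norm_fderiv_summand_basisVector_zero_le`
is the estimate announced in the stub's context: on the slab `{x⁰ = t}`, at lab distance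
`d = ‖x̲ − ξ(t)‖ ≥ max 1 (2|a|)` from the painted centre,

  `‖D S(x)[e₀]‖ ≤ |M| G² ( (B₁G + 2B₀) ν / d + B₁ G ‖ξ̇(t)‖ / d² )`,   `G = 1 + 3γ`,

for the summand `S(y) = boostedKerrBilin (Λ(y⁰)) (y⁰, ξ(y⁰)) M a y − η`, where `B₀, B₁` are the
universal Kerr–Schild decay constants (`…Decay`) and `ν ≥ 0` is ANY bound of the body-frame rate
`ω = Λ(t)⁻¹Λ̇(t)` modulo an infinitesimal stabiliser element `ω_K` of `g_{M,a}` at the rest-frame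
point (`‖(ω − ω_K)u‖ ≤ ν‖u‖`, `D(g−η)(p)[ω_K p] + (g−η)(p)(ω_K·, ·) + (g−η)(p)(·, ω_K·) = 0`).
The `Λ̇`-channel has kernel `M/d` and is blind to the stabiliser; the `ξ̇`-channel has kernel `M/d²`.
-/

noncomputable section

namespace Summit.FinalStateConjecture.FinalStateConjecture.Theorems.SublinearIsFree.QuasiStationarity

open scoped BigOperators Topology ContDiff
open Filter Set Function Literature.Geometry.Lorentzian
open Summit.FinalStateConjecture.FinalStateConjecture.Theorems
open Summit.FinalStateConjecture.FinalStateConjecture.Theorems.InertialRecession.Negative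

/-- `‖(0, z)‖ = ‖z‖` for the slice embedding. [folklore] -/
theorem norm_spaceEmbed (z : E3) : ‖E4.spaceEmbed z‖ = ‖z‖ := by
  have h0 : (E4.spaceEmbed z) 0 = 0 := by simp
  rw [norm_eq_spatialNorm_of_apply_zero_eq_zero h0, E4.spaceEmbed_apply, E4.spatialNorm_ofTimeSpace]

-- operator-norm instance paths on form-valued maps are slow to unify
set_option synthInstance.maxHeartbeats 200000 in
/-- **Scalar bookkeeping for the rate expansion.** For a bilinear form `K`, a derivative `D`
(consumed only through `‖D u‖ ≤ δ₁‖u‖`), operators `A`, `W`, `T` with `T = W − SK`, the stabiliser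
identity for `SK` at `p = A q`, and `‖T u‖ ≤ ν‖u‖`: the chain-rule value
`D(−W p − e)(Av, Aw) + K(−W(Av), Aw) + K(Av, −W(Aw))` is bounded by
`(δ₁ ν ‖p‖ + 2‖K‖ν + δ₁‖e‖) ‖Av‖ ‖Aw‖`. [folklore] -/
theorem abs_rate_expansion_le (D : E4 →L[ℝ] E4 →L[ℝ] E4 →L[ℝ] ℝ) (K : E4 →L[ℝ] E4 →L[ℝ] ℝ)
    (W SK : E4 →L[ℝ] E4) (p e av aw : E4) {δ₁ ν : ℝ} (hδ₁ : ∀ u, ‖D u‖ ≤ δ₁ * ‖u‖)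
    (hν : ∀ u, ‖(W - SK) u‖ ≤ ν * ‖u‖) (hδ0 : 0 ≤ δ₁)
    (hstab : D (SK p) av aw + K (SK av) aw + K av (SK aw) = 0) :
    |D (-(W p) + -e) av aw + K (-(W av)) aw + K av (-(W aw))| ≤
      (δ₁ * ν * ‖p‖ + 2 * ‖K‖ * ν + δ₁ * ‖e‖) * ‖av‖ * ‖aw‖ := by
  -- rewrite `W = T + SK` and use the stabiliser identity
  have hT : ∀ u, W u = (W - SK) u + SK u := fun u ↦ by simp [sub_apply]
  have hval : D (-(W p) + -e) av aw + K (-(W av)) aw + K av (-(W aw)) =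
      -(D ((W - SK) p) av aw + K ((W - SK) av) aw + K av ((W - SK) aw)) - D e av aw := by
    rw [hT p, hT av, hT aw]
    simp only [map_add, map_neg, add_apply, neg_apply]
    linarith [hstab]
  rw [hval]
  have h1 : |D ((W - SK) p) av aw| ≤ δ₁ * ν * ‖p‖ * ‖av‖ * ‖aw‖ := by
    refine (Real.norm_eq_abs _ ▸ (D ((W - SK) p)).le_opNorm₂ av aw).trans ?_
    have h := (hδ₁ ((W - SK) p)).trans (mul_le_mul_of_nonneg_left (hν p) hδ0)
    have : ‖D ((W - SK) p)‖ ≤ δ₁ * ν * ‖p‖ := by nlinarith [h]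
    gcongr
  have h2 : |K ((W - SK) av) aw| ≤ ‖K‖ * ν * ‖av‖ * ‖aw‖ := by
    refine (Real.norm_eq_abs _ ▸ K.le_opNorm₂ ((W - SK) av) aw).trans ?_
    have h := hν av
    have hK := norm_nonneg K
    calc ‖K‖ * ‖(W - SK) av‖ * ‖aw‖ ≤ ‖K‖ * (ν * ‖av‖) * ‖aw‖ := by gcongr
      _ = ‖K‖ * ν * ‖av‖ * ‖aw‖ := by ring
  have h3 : |K av ((W - SK) aw)| ≤ ‖K‖ * ν * ‖av‖ * ‖aw‖ := by
    refine (Real.norm_eq_abs _ ▸ K.le_opNorm₂ av ((W - SK) aw)).trans ?_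
    have h := hν aw
    calc ‖K‖ * ‖av‖ * ‖(W - SK) aw‖ ≤ ‖K‖ * ‖av‖ * (ν * ‖aw‖) := by gcongr
      _ = ‖K‖ * ν * ‖av‖ * ‖aw‖ := by ring
  have h4 : |D e av aw| ≤ δ₁ * ‖e‖ * ‖av‖ * ‖aw‖ := by
    refine (Real.norm_eq_abs _ ▸ (D e).le_opNorm₂ av aw).trans ?_
    have h := hδ₁ e
    gcongr
  calc |-(D ((W - SK) p) av aw + K ((W - SK) av) aw + K av ((W - SK) aw)) - D e av aw|
      ≤ |D ((W - SK) p) av aw| + |K ((W - SK) av) aw| + |K av ((W - SK) aw)| + |D e av aw| := by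
        have := abs_add_le (D ((W - SK) p) av aw + K ((W - SK) av) aw) (K av ((W - SK) aw))
        have := abs_add_le (D ((W - SK) p) av aw) (K ((W - SK) av) aw)
        have := abs_sub (-(D ((W - SK) p) av aw + K ((W - SK) av) aw + K av ((W - SK) aw)))
          (D e av aw)
        rw [abs_neg] at this
        linarith
    _ ≤ δ₁ * ν * ‖p‖ * ‖av‖ * ‖aw‖ + ‖K‖ * ν * ‖av‖ * ‖aw‖ + ‖K‖ * ν * ‖av‖ * ‖aw‖ +
        δ₁ * ‖e‖ * ‖av‖ * ‖aw‖ := by linarith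
    _ = (δ₁ * ν * ‖p‖ + 2 * ‖K‖ * ν + δ₁ * ‖e‖) * ‖av‖ * ‖aw‖ := by ring

-- operator-norm instance paths on form-valued maps are slow to unify
set_option synthInstance.maxHeartbeats 200000 in
/-- **The lab-time derivative of one painted summand is linear in the rates, with kernels `M/d`
and `M/d²`.** There are universal `B₀, B₁ ≥ 0` such that for every Kerr parameter `(M, a)`, every
`C¹` Lorentz motion `Λ` with Lorentz factor `|(Λ(t)e₀)⁰| ≤ γ`, every `C¹` centre `ξ`, every slab
point `x` (`x⁰ = t`) with `d = ‖x̲ − ξ(t)‖ ≥ max 1 (2|a|)`, and every `ν ≥ 0` bounding the body rate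
`ω = Λ(t)⁻¹Λ̇(t)` modulo a stabiliser element `ω_K` at the rest-frame point
`p = Λ(t)⁻¹(0, x̲ − ξ(t))`,
`‖D S(x)[e₀]‖ ≤ |M| G² ((B₁G + 2B₀) ν / d + B₁ G ‖ξ̇(t)‖ / d²)` with `G = 1 + 3γ`, for the summand
`S(y) = boostedKerrBilin (Λ(y⁰)) (y⁰, ξ(y⁰)) M a y − η` of the crux's background field. This is the
quantitative form of "for frozen moduli the painted background is lab-static": all of `∂₀` falls
on the rates `Λ̇` (kernel `M/d`, stabiliser-blind) and `ξ̇` (kernel `M/d²`). [cite: KerrSchild1965, §3] -/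
theorem norm_fderiv_summand_basisVector_zero_le :
    ∃ B₀ B₁ : ℝ, 0 ≤ B₀ ∧ 0 ≤ B₁ ∧ ∀ (M a γ : ℝ) (Λ : ℝ → lorentzGroup) (ξ : ℝ → E3) (t : ℝ)
      (x : E4) (SK : E4 →L[ℝ] E4) (ν : ℝ),
      ContDiff ℝ 1 (fun s ↦ ((Λ s : E4 ≃L[ℝ] E4) : E4 →L[ℝ] E4)) → ContDiff ℝ 1 ξ →
      |((Λ t : E4 ≃L[ℝ] E4) (E4.basisVector 0)) 0| ≤ γ → x 0 = t →
      max 1 (2 * |a|) ≤ ‖E4.spatial x - ξ t‖ → 0 ≤ ν →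
      (∀ v w, fderiv ℝ (fun y ↦ Kerr.bilin M a y - Minkowski.bilin)
          ((((Λ t : E4 ≃L[ℝ] E4).symm : E4 →L[ℝ] E4)) (E4.spaceEmbed (E4.spatial x - ξ t)))
          (SK ((((Λ t : E4 ≃L[ℝ] E4).symm : E4 →L[ℝ] E4)) (E4.spaceEmbed (E4.spatial x - ξ t))))
          v w +
        (Kerr.bilin M a ((((Λ t : E4 ≃L[ℝ] E4).symm : E4 →L[ℝ] E4))
          (E4.spaceEmbed (E4.spatial x - ξ t))) - Minkowski.bilin) (SK v) w +
        (Kerr.bilin M a ((((Λ t : E4 ≃L[ℝ] E4).symm : E4 →L[ℝ] E4))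
          (E4.spaceEmbed (E4.spatial x - ξ t))) - Minkowski.bilin) v (SK w) = 0) →
      (∀ u, ‖((((Λ t : E4 ≃L[ℝ] E4).symm : E4 →L[ℝ] E4)).comp
          (deriv (fun s ↦ ((Λ s : E4 ≃L[ℝ] E4) : E4 →L[ℝ] E4)) t) - SK) u‖ ≤ ν * ‖u‖) →
      ‖fderiv ℝ (fun y : E4 ↦ boostedKerrBilin (Λ (y 0)) (E4.ofTimeSpace (y 0) (ξ (y 0))) M a y -
          Minkowski.bilin) x (E4.basisVector 0)‖ ≤
        |M| * (1 + 3 * γ) ^ 2 * ((B₁ * (1 + 3 * γ) + 2 * B₀) * ν / ‖E4.spatial x - ξ t‖ +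
          B₁ * (1 + 3 * γ) * ‖deriv ξ t‖ / ‖E4.spatial x - ξ t‖ ^ 2) := by
  obtain ⟨B₀, hB₀, hK0⟩ := exists_norm_ksPert_le
  obtain ⟨B₁, hB₁, hK1⟩ := exists_norm_iteratedFDeriv_one_ksPert_le
  refine ⟨B₀, B₁, hB₀, hB₁, ?_⟩
  intro M a γ Λ ξ t x SK ν hΛ hξ hγ hx hd hν0 hstab hν
  -- names
  set Lpath : ℝ → E4 →L[ℝ] E4 := fun s ↦ ((Λ s : E4 ≃L[ℝ] E4) : E4 →L[ℝ] E4) with hLpath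
  set Apath : ℝ → E4 →L[ℝ] E4 := fun s ↦ (((Λ s : E4 ≃L[ℝ] E4).symm : E4 →L[ℝ] E4)) with hApath
  set A : E4 →L[ℝ] E4 := (((Λ t : E4 ≃L[ℝ] E4).symm : E4 →L[ℝ] E4)) with hAdef
  set L' : E4 →L[ℝ] E4 := deriv Lpath t with hL'
  set K : E4 → E4 →L[ℝ] E4 →L[ℝ] ℝ := fun y ↦ Kerr.bilin M a y - Minkowski.bilin with hKdef
  set z : E3 := E4.spatial x with hz
  set d : ℝ := ‖z - ξ t‖ with hddef
  set p : E4 := A (E4.spaceEmbed (z - ξ t)) with hpdef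
  set G : ℝ := 1 + 3 * γ with hG
  -- sizes
  have hγ1 : 1 ≤ γ := (one_le_abs_lorentz_apply_zero (Λ t)).trans hγ
  have hG0 : 0 ≤ G := by rw [hG]; linarith
  have hAG : ‖A‖ ≤ G := (norm_lorentz_symm_le' (Λ t)).trans (by rw [hG]; linarith)
  have hd1 : 1 ≤ d := (le_max_left _ _).trans hd
  have hd0 : 0 < d := one_pos.trans_le hd1
  have hσ : d ≤ E4.spatialNorm p := le_spatialNorm_restPosition (Λ t) _
  have hσ0 : 0 < E4.spatialNorm p := hd0.trans_le hσ
  have hσ' : max 1 (2 * |a|) ≤ E4.spatialNorm p := hd.trans hσ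
  have hp : ‖p‖ ≤ G * d := by
    rw [hpdef]
    refine (A.le_opNorm _).trans ?_
    rw [norm_spaceEmbed]
    exact mul_le_mul_of_nonneg_right hAG (norm_nonneg _)
  -- derivatives of the paths
  have hΛ' : HasDerivAt Lpath L' t := (hΛ.differentiable one_ne_zero t).hasDerivAt
  have hA : HasDerivAt Apath (-(A.comp (L'.comp A))) t := hasDerivAt_lorentz_symm one_ne_zero hΛ hΛ'
  have hξ' : HasDerivAt ξ (deriv ξ t) t := (hξ.differentiable one_ne_zero t).hasDerivAt
  have hKdiff : DifferentiableAt ℝ K p := differentiableAt_ksPert_of_le hσ'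
  -- Kerr–Schild decay at the rest-frame point
  have hK0p : ‖K p‖ ≤ |M| * B₀ / d := by
    refine (hK0 M a p hσ').trans ?_
    exact div_le_div_of_nonneg_left (by positivity) hd0 hσ
  have hK1p : ‖iteratedFDeriv ℝ 1 K p‖ ≤ |M| * B₁ / d ^ 2 := by
    refine (hK1 M a p hσ').trans ?_
    exact div_le_div_of_nonneg_left (by positivity) (by positivity)
      (pow_le_pow_left₀ hd0.le hσ 2)
  have hδ₁ : ∀ u, ‖fderiv ℝ K p u‖ ≤ |M| * B₁ / d ^ 2 * ‖u‖ := fun u ↦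
    (norm_fderiv_apply_le_of_iteratedFDeriv_one K p u).trans
      (mul_le_mul_of_nonneg_right hK1p (norm_nonneg u))
  -- the summand is differentiable at `x`
  have hS := (contDiffAt_summand (M := M) (a := a) hΛ hξ hx hd).differentiableAt one_ne_zero
  -- pointwise bound on `D S(x)[e₀](v, w)`
  set C : ℝ := |M| * G ^ 2 * ((B₁ * G + 2 * B₀) * ν / d + B₁ * G * ‖deriv ξ t‖ / d ^ 2) with hC
  have hC0 : 0 ≤ C := by positivity
  refine ContinuousLinearMap.opNorm_le_bound₂ _ hC0 fun v w ↦ ?_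
  have hδ := hasDerivAt_restFrame_scalar M a hA hξ' z hKdiff v w
  have heq := fderiv_summand_basisVector_zero_apply hx hS v w hδ
  rw [Real.norm_eq_abs, heq]
  -- rewrite `A' u = −ω(Au)` with `ω = A Λ̇`
  set W : E4 →L[ℝ] E4 := A.comp L' with hW
  have hA'u : ∀ u, (-(A.comp (L'.comp A))) u = -(W (A u)) := fun u ↦ by
    simp [hW]
  have hq' : (-(A.comp (L'.comp A))) (E4.spaceEmbed (z - ξ t)) + Apath t (E4.spaceEmbed (-deriv ξ t)) =
      -(W p) + -(A (E4.spaceEmbed (deriv ξ t))) := by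
    rw [hA'u, map_neg, map_neg]
  rw [hq', hA'u, hA'u]
  have key := abs_rate_expansion_le (fderiv ℝ K p) (K p) W SK p (A (E4.spaceEmbed (deriv ξ t)))
    (A v) (A w) hδ₁ hν (by positivity) (hstab (A v) (A w))
  refine key.trans ?_
  -- sizes of the pieces
  have hAv : ‖A v‖ ≤ G * ‖v‖ := (A.le_opNorm v).trans (mul_le_mul_of_nonneg_right hAG (norm_nonneg _))
  have hAw : ‖A w‖ ≤ G * ‖w‖ := (A.le_opNorm w).trans (mul_le_mul_of_nonneg_right hAG (norm_nonneg _))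
  have he : ‖A (E4.spaceEmbed (deriv ξ t))‖ ≤ G * ‖deriv ξ t‖ := by
    refine (A.le_opNorm _).trans ?_
    rw [norm_spaceEmbed]
    exact mul_le_mul_of_nonneg_right hAG (norm_nonneg _)
  have hcoef : |M| * B₁ / d ^ 2 * ν * ‖p‖ + 2 * ‖K p‖ * ν + |M| * B₁ / d ^ 2 * ‖A (E4.spaceEmbed (deriv ξ t))‖
      ≤ |M| * ((B₁ * G + 2 * B₀) * ν / d + B₁ * G * ‖deriv ξ t‖ / d ^ 2) := by
    have h1 : |M| * B₁ / d ^ 2 * ν * ‖p‖ ≤ |M| * B₁ * G * ν / d := by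
      have : |M| * B₁ / d ^ 2 * ν * ‖p‖ ≤ |M| * B₁ / d ^ 2 * ν * (G * d) :=
        mul_le_mul_of_nonneg_left hp (by positivity)
      refine this.trans (le_of_eq ?_)
      field_simp
    have h2 : 2 * ‖K p‖ * ν ≤ 2 * (|M| * B₀ / d) * ν := by gcongr
    have h3 : |M| * B₁ / d ^ 2 * ‖A (E4.spaceEmbed (deriv ξ t))‖ ≤
        |M| * B₁ / d ^ 2 * (G * ‖deriv ξ t‖) := mul_le_mul_of_nonneg_left he (by positivity)
    have hsum := add_le_add (add_le_add h1 h2) h3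
    refine hsum.trans (le_of_eq ?_)
    field_simp
  have hvw : ‖A v‖ * ‖A w‖ ≤ G * ‖v‖ * (G * ‖w‖) :=
    mul_le_mul hAv hAw (norm_nonneg _) (by positivity)
  calc (|M| * B₁ / d ^ 2 * ν * ‖p‖ + 2 * ‖K p‖ * ν +
        |M| * B₁ / d ^ 2 * ‖A (E4.spaceEmbed (deriv ξ t))‖) * ‖A v‖ * ‖A w‖
      ≤ |M| * ((B₁ * G + 2 * B₀) * ν / d + B₁ * G * ‖deriv ξ t‖ / d ^ 2) * (G * ‖v‖ * (G * ‖w‖)) := by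
        rw [mul_assoc]
        exact mul_le_mul hcoef hvw (by positivity) (by positivity)
    _ = C * ‖v‖ * ‖w‖ := by rw [hC]; ring

/-! ### The stabiliser correction of the body-frame rate -/

/-- Linearity bookkeeping: the stabiliser functional
`X ↦ D[X p](v, w) + K(X v, w) + K(v, X w)` of a linear combination. [folklore] -/
theorem stabFunctional_smul_add (D : E4 →L[ℝ] E4 →L[ℝ] E4 →L[ℝ] ℝ) (K : E4 →L[ℝ] E4 →L[ℝ] ℝ)
    (J₁ J₂ J₃ : E4 →L[ℝ] E4) (c₁ c₂ c₃ : ℝ) (p v w : E4) :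
    D ((c₁ • J₁ + c₂ • J₂ + c₃ • J₃) p) v w + K ((c₁ • J₁ + c₂ • J₂ + c₃ • J₃) v) w +
        K v ((c₁ • J₁ + c₂ • J₂ + c₃ • J₃) w) =
      c₁ * (D (J₁ p) v w + K (J₁ v) w + K v (J₁ w)) +
      c₂ * (D (J₂ p) v w + K (J₂ v) w + K v (J₂ w)) +
      c₃ * (D (J₃ p) v w + K (J₃ v) w + K v (J₃ w)) := by
  simp only [add_apply, FunLike.coe_smul, Pi.smul_apply, map_add, map_smul, smul_eq_mul]
  ring

/-- The derivative of the spin-axis rotation at angle `0` is the generator `J12`. [folklore] -/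
theorem hasDerivAt_rotCLM_zero : HasDerivAt rotCLM J12 0 := by
  refine (hasDerivAt_rotCLM 0).congr_deriv ?_
  refine ContinuousLinearMap.ext fun u ↦ ?_
  have hu : rotCLM' 0 u 0 = J12 u 0 ∧ rotCLM' 0 u 1 = J12 u 1 ∧ rotCLM' 0 u 2 = J12 u 2 ∧
      rotCLM' 0 u 3 = J12 u 3 := by
    obtain ⟨j0, j1, j2, j3⟩ := J12_apply u
    rw [j0, j1, j2, j3]
    simp
  ext k
  fin_cases k
  · exact hu.1
  · exact hu.2.1
  · exact hu.2.2.1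
  · exact hu.2.2.2

-- operator-norm instance paths on form-valued maps are slow to unify
set_option synthInstance.maxHeartbeats 200000 in
/-- **The stabiliser correction.** At a point `p` where `g_{M,a} − η` is differentiable, the
body-frame rate `ω = Λ(t)⁻¹Λ̇(t)` of a Lorentz motion can be corrected by an infinitesimal
stabiliser element `ω_K` (a rotation about the spin axis `e₃`; any rotation if `a = 0`) so that
(i) `ω_K` satisfies the stabiliser identity `D(g−η)(p)[ω_K p](v,w) + (g−η)(p)(ω_K v, w) +
(g−η)(p)(v, ω_K w) = 0`, and (ii) `‖(ω − ω_K)u‖ ≤ 4(1 + 3γ)(‖Λ̇e₀‖ + [a ≠ 0]‖Λ̇e₃‖)‖u‖`: the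
corrected rate is controlled by the rate of the 4-velocity `u = Λe₀` and, for a spinning hole, of
the spin axis `Λe₃` — never by the rotation of the frame about the axis (the painting-rigidity
loophole of `kerrSchildPaintingRigidity_false_of_witness`). [folklore] -/
theorem exists_stabiliser_correction (M a γ : ℝ) (Λ : ℝ → lorentzGroup) (t : ℝ)
    {L' : E4 →L[ℝ] E4}
    (hΛ' : HasDerivAt (fun s ↦ ((Λ s : E4 ≃L[ℝ] E4) : E4 →L[ℝ] E4)) L' t)
    (hγ : |((Λ t : E4 ≃L[ℝ] E4) (E4.basisVector 0)) 0| ≤ γ) {p : E4}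
    (hp : DifferentiableAt ℝ (fun y ↦ Kerr.bilin M a y - Minkowski.bilin) p) :
    ∃ SK : E4 →L[ℝ] E4,
      (∀ v w, fderiv ℝ (fun y ↦ Kerr.bilin M a y - Minkowski.bilin) p (SK p) v w +
        (Kerr.bilin M a p - Minkowski.bilin) (SK v) w +
        (Kerr.bilin M a p - Minkowski.bilin) v (SK w) = 0) ∧
      ∀ u, ‖((((Λ t : E4 ≃L[ℝ] E4).symm : E4 →L[ℝ] E4)).comp L' - SK) u‖ ≤
        4 * (1 + 3 * γ) * (‖L' (E4.basisVector 0)‖ +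
          if a = 0 then 0 else ‖L' (E4.basisVector 3)‖) * ‖u‖ := by
  set A : E4 →L[ℝ] E4 := (((Λ t : E4 ≃L[ℝ] E4).symm : E4 →L[ℝ] E4)) with hAdef
  set W : E4 →L[ℝ] E4 := A.comp L' with hW
  set D := fderiv ℝ (fun y ↦ Kerr.bilin M a y - Minkowski.bilin) p with hD
  set K := Kerr.bilin M a p - Minkowski.bilin with hK
  have hGA : ‖A‖ ≤ 1 + 3 * γ := (norm_lorentz_symm_le' (Λ t)).trans (by linarith)
  have hG0 : 0 ≤ 1 + 3 * γ := le_trans (by norm_num) ((norm_lorentz_symm_le' (Λ t)).trans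
    (by linarith) |> le_trans (norm_nonneg _))
  have hω : ∀ v w, Minkowski.bilin (W v) w + Minkowski.bilin v (W w) = 0 := fun v w ↦ by
    have h := minkowski_bodyRate_antisymm hΛ' v w
    simpa [hW, hAdef] using h
  have hWe : ∀ μ, ‖W (E4.basisVector μ)‖ ≤ (1 + 3 * γ) * ‖L' (E4.basisVector μ)‖ := fun μ ↦ by
    rw [hW, ContinuousLinearMap.comp_apply]
    exact (A.le_opNorm _).trans (mul_le_mul_of_nonneg_right hGA (norm_nonneg _))
  by_cases ha : a = 0
  · -- Schwarzschild: remove the whole rotation part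
    refine ⟨(W (E4.basisVector 1) 2) • J12 + (W (E4.basisVector 2) 3) • J23 +
      (W (E4.basisVector 3) 1) • J31, fun v w ↦ ?_, fun u ↦ ?_⟩
    · have hgen : ∀ J : E4 →L[ℝ] E4, (J = J12 ∨ J = J23 ∨ J = J31) →
          D (J p) v w + K (J v) w + K v (J w) = 0 := by
        intro J hJ
        obtain ⟨h1, h2, h3⟩ := rotGen_props J hJ
        subst ha
        exact stabiliser_generator_identity hp
          (R := fun θ ↦ 1 + Real.sin θ • J + (1 - Real.cos θ) • J.comp J) (J := J)
          (rotCurve_zero_apply J) (hasDerivAt_rotCurve J)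
          (fun θ v w ↦ kerrBilin_zero_spin_invariant
            (R := fun u ↦ (1 + Real.sin θ • J + (1 - Real.cos θ) • J.comp J) u)
            (minkowski_rotCurve h1 h2 θ) (rotCurve_basisVector_zero h3 θ) M p v w)
          (fun θ v w ↦ minkowski_rotCurve h1 h2 θ v w) v w
      rw [stabFunctional_smul_add, hgen J12 (Or.inl rfl), hgen J23 (Or.inr (Or.inl rfl)),
        hgen J31 (Or.inr (Or.inr rfl))]
      ring
    · refine (norm_sub_rotStab_apply_le W hω u).trans ?_
      rw [if_pos ha, add_zero]
      have h0 := hWe 0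
      have hu := norm_nonneg u
      nlinarith [mul_le_mul_of_nonneg_right h0 hu]
  · -- spinning Kerr: remove the rotation about the spin axis
    refine ⟨(W (E4.basisVector 1) 2) • J12, fun v w ↦ ?_, fun u ↦ ?_⟩
    · have hgen : D (J12 p) v w + K (J12 v) w + K v (J12 w) = 0 :=
        stabiliser_generator_identity hp (R := rotCLM) (J := J12) rotCLM_zero
          hasDerivAt_rotCLM_zero (fun θ v w ↦ kerrBilin_rotCLM θ M a p v w)
          (fun θ v w ↦ minkowski_rotCLM θ v w) v w
      simp only [map_smul, smul_eq_mul, smul_apply]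
      linear_combination (W (E4.basisVector 1) 2) * hgen
    · refine (norm_sub_spinStab_apply_le W hω u).trans ?_
      rw [if_neg ha]
      have h0 := hWe 0
      have h3 := hWe 3
      have hu := norm_nonneg u
      have hsum : ‖W (E4.basisVector 0)‖ + ‖W (E4.basisVector 3)‖ ≤
          (1 + 3 * γ) * (‖L' (E4.basisVector 0)‖ + ‖L' (E4.basisVector 3)‖) := by linarith
      have hL0 := norm_nonneg (L' (E4.basisVector 0))
      have hL3 := norm_nonneg (L' (E4.basisVector 3))
      calc 3 * (‖W (E4.basisVector 0)‖ + ‖W (E4.basisVector 3)‖) * ‖u‖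
          ≤ 3 * ((1 + 3 * γ) * (‖L' (E4.basisVector 0)‖ + ‖L' (E4.basisVector 3)‖)) * ‖u‖ := by
            gcongr
        _ ≤ 4 * (1 + 3 * γ) * (‖L' (E4.basisVector 0)‖ + ‖L' (E4.basisVector 3)‖) * ‖u‖ := by
            nlinarith [mul_nonneg (mul_nonneg hG0 (add_nonneg hL0 hL3)) hu]

-- operator-norm instance paths on form-valued maps are slow to unify
set_option synthInstance.maxHeartbeats 200000 in
/-- Registered sub-goal form (stub `painted_summand_rate_bound` of the crux item) of
`norm_fderiv_summand_basisVector_zero_le` (with `(0, z)` written `E4.ofTimeSpace 0 z`): the lab-time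
derivative of one painted summand is linear in the rates, kernels `M/d` (stabiliser-blind) and `M/d²`
(Kerr–Schild 1965, §3). [cite: KerrSchild1965, §3] -/
theorem painted_summand_rate_bound : open Literature.Geometry.Lorentzian Filter Topology in ∃ B₀ B₁ : ℝ, 0 ≤ B₀ ∧ 0 ≤ B₁ ∧ ∀ (M a γ : ℝ) (Λ : ℝ → lorentzGroup) (ξ : ℝ → E3) (t : ℝ) (x : E4) (SK : E4 →L[ℝ] E4) (ν : ℝ), ContDiff ℝ 1 (fun s ↦ ((Λ s : E4 ≃L[ℝ] E4) : E4 →L[ℝ] E4)) → ContDiff ℝ 1 ξ → |((Λ t : E4 ≃L[ℝ] E4) (E4.basisVector 0)) 0| ≤ γ → x 0 = t → max 1 (2 * |a|) ≤ ‖E4.spatial x - ξ t‖ → 0 ≤ ν → (∀ v w : E4, fderiv ℝ (fun y ↦ Kerr.bilin M a y - Minkowski.bilin) ((((Λ t : E4 ≃L[ℝ] E4).symm : E4 →L[ℝ] E4)) (E4.ofTimeSpace 0 (E4.spatial x - ξ t))) (SK ((((Λ t : E4 ≃L[ℝ] E4).symm : E4 →L[ℝ] E4)) (E4.ofTimeSpace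 0 (E4.spatial x - ξ t)))) v w + (Kerr.bilin M a ((((Λ t : E4 ≃L[ℝ] E4).symm : E4 →L[ℝ] E4)) (E4.ofTimeSpace 0 (E4.spatial x - ξ t))) - Minkowski.bilin) (SK v) w + (Kerr.bilin M a ((((Λ t : E4 ≃L[ℝ] E4).symm : E4 →L[ℝ] E4)) (E4.ofTimeSpace 0 (E4.spatial x - ξ t))) - Minkowski.bilin) v (SK w) = 0) → (∀ u : E4, ‖((((Λ t : E4 ≃L[ℝ] E4).symm : E4 →L[ℝ] E4)).comp (deriv (fun s ↦ ((Λ s : E4 ≃L[ℝ] E4) : E4 →L[ℝ] E4)) t) - SK) u‖ ≤ ν * ‖u‖) → ‖fderiv ℝ (fun y : E4 ↦ boostedKerrBilin (Λ (y 0)) (E4.ofTimeSpace (y 0) (ξ (y 0))) M a y - Minkowski.bilin) x (E4.basisVector 0)‖ ≤ |M| * (1 + 3 * γ) ^ 2 * ((B₁ * (1 + 3 * γ) + 2 * B₀) * ν / ‖E4.spatial x - ξ t‖ + B₁ * (1 + 3 * γ) * ‖deriv ξ t‖ / ‖E4.spatial x - ξ t‖ ^ 2) :=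
  norm_fderiv_summand_basisVector_zero_le

end Summit.FinalStateConjecture.FinalStateConjecture.Theorems.SublinearIsFree.QuasiStationarity

end
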